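import Literature.AnabelianGeometry.AbsoluteAnabelian.GaloisCyclotomeMLFHolds
import Mathlib.Algebra.Ring.Action.Field
import HarnessLib

/-!
# Torsion reciprocity data are NOT unique: the inverse twist (kernel witness for a DEFS-lane note)

S. Mochizuki, *The Absolute Anabelian Geometry of Hyperbolic Curves* (2004) [AbsAnab], Prop 1.2.1 (vi)
p. 10–11 («the morphisms induced by `α` on the abelianizations of the various open subgroups … induce an
isomorphism `μ_{ℚ/ℤ}(K̄₁) ⥲ μ_{ℚ/ℤ}(K̄₂)`»), and *Topics in Absolute Anabelian Geometry III* [AbsTopIII],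
Rmk 3.2.1 p. 73 (THE natural isomorphism `μ_Ẑ(M_TM) ⥲ μ_Ẑ(G)` is pinned «by imposing the condition of
“compatibility with the natural isomorphism of Corollary 1.10, (a)”»), Rmk 3.2.2 / Prop 3.3 (i) p. 73 (for
`O^×` the isomorphism is «only determined up to a `Ẑ^×`-multiple»).

PROOF-ONLY file (no definitions).  The tree packages the local-class-field-theory input for
`μ_{ℚ/ℤ}(G_k) ≅ μ(k̄)` as the STRUCTURE `TorsionReciprocityData k` (axioms (T1)–(T4),
`GaloisCyclotomeMLFReduction.lean`) and several junction files CHOOSE such a datum (`Classical.choice`,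
e.g. `MLFClosure.reciprocityData`) to identify the group-theoretic cyclotome `μ_Ẑ(G_k)` with `Λ(k̄ˣ)`.  This
file records in the kernel that (T1)–(T4) do NOT determine the datum: composing every `θ_U` with inversion
gives another datum (`exists_inv_twist`), whose identification `μ_{ℚ/ℤ}(G_k) ≅ μ(k̄)` is the NEGATIVE of the
original (`muLift`, `equiv`), and which differs from it as soon as `k̄` has a root of unity of order `> 2` —
always, in characteristic `0` (`equiv_ne_of_inv_twist`, `exists_ne` : two data with different `equiv`).
Hence a junction built on a CHOSEN datum is print's canonical identification only up to (at least) `±1`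
(in fact up to `Ẑ^×`); print pins it by the `H²`-invariant compatibility of Rmk 3.2.1 (cf. the kernel
statements `Prop121vii.invariantMap_comp_cohTransport_refl_eq_self_iff` et al.: an `H²`-residue condition
pins exactly such twists).  Classical bookkeeping; nothing here bears on [IUTchIII] Cor. 3.12.
-/

noncomputable section

universe u

namespace Literature.AnabelianGeometry.AbsoluteAnabelian

namespace TorsionReciprocityData

variable {k : Type u} [Field k] [CharZero k]

/-- **The inverse twist of torsion reciprocity data**: composing every `θ_U : (U^ab)_tors → k̄ˣ` with
inversion `ζ ↦ ζ⁻¹` again satisfies (T1)–(T4) (injectivity; Verlagerung- and conjugation-compatibility,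
both homomorphic; exhaustion, inversion being a bijection of `μ(k̄)`).  So the axioms do not single out the
Artin-normalised datum. [cite: MochizukiAbsAnab2004, Prop 1.2.1 (vi) p.10] -/
theorem exists_inv_twist (D : TorsionReciprocityData k) :
    ∃ D' : TorsionReciprocityData k, ∀ (U : OpenSubgroup (Field.absoluteGaloisGroup k))
      (x : abelianizationTorsion (U : Subgroup (Field.absoluteGaloisGroup k))), D'.θ U x = (D.θ U x)⁻¹ := by
  refine ⟨{ θ := fun U => invMonoidHom.comp (D.θ U)
            θ_injective := fun U => inv_injective.comp (D.θ_injective U)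
            θ_verlagerung := fun U V h x => ?_
            θ_conj := fun σ U x => ?_
            θ_exhaust := fun ζ hζ => ?_ }, fun U x => rfl⟩
  · change (D.θ V (verlagerungTorsion U.isOpen V.isOpen (OpenSubgroup.toSubgroup_le.mpr h) x))⁻¹ = (D.θ U x)⁻¹
    rw [D.θ_verlagerung U V h x]
  · change (((D.θ (imageOpenSubgroup (conjContinuousMulEquiv σ) U)
        (torsionTransport (conjContinuousMulEquiv σ) U x))⁻¹ : (AlgebraicClosure k)ˣ) : AlgebraicClosure k) =
      σ • (((D.θ U x)⁻¹ : (AlgebraicClosure k)ˣ) : AlgebraicClosure k)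
    rw [Units.val_inv_eq_inv_val, Units.val_inv_eq_inv_val, D.θ_conj σ U x, smul_inv'']
  · obtain ⟨U, x, hx⟩ := D.θ_exhaust ζ⁻¹ (inv_mem hζ)
    exact ⟨U, x, by change (D.θ U x)⁻¹ = ζ; rw [hx, inv_inv]⟩

/-- On the direct limit the inverse twist NEGATES `muLift : μ_{ℚ/ℤ}(G_k) → k̄ˣ` (additive notation).
[cite: MochizukiAbsAnab2004, Prop 1.2.1 (vi) p.10] -/
theorem muLift_eq_neg_of_inv_twist {D D' : TorsionReciprocityData k}
    (h : ∀ (U : OpenSubgroup (Field.absoluteGaloisGroup k))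
      (x : abelianizationTorsion (U : Subgroup (Field.absoluteGaloisGroup k))), D'.θ U x = (D.θ U x)⁻¹)
    (z : muQZ (Field.absoluteGaloisGroup k)) : D'.muLift z = -D.muLift z := by
  obtain ⟨U, x, rfl⟩ := muQZ.exists_of z
  rw [muLift_of, muLift_of, h U x]
  rfl

/-- … hence NEGATES the identification `equiv : μ_{ℚ/ℤ}(G_k) ≃+ (k̄ˣ)_tors` (values in `k̄ˣ`).
[cite: MochizukiAbsAnab2004, Prop 1.2.1 (vi) p.10] -/
theorem coe_equiv_of_inv_twist {D D' : TorsionReciprocityData k}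
    (h : ∀ (U : OpenSubgroup (Field.absoluteGaloisGroup k))
      (x : abelianizationTorsion (U : Subgroup (Field.absoluteGaloisGroup k))), D'.θ U x = (D.θ U x)⁻¹)
    (z : muQZ (Field.absoluteGaloisGroup k)) :
    ((Additive.toMul (D'.equiv z) : CommGroup.torsion (AlgebraicClosure k)ˣ) : (AlgebraicClosure k)ˣ) =
      ((Additive.toMul (D.equiv z) : CommGroup.torsion (AlgebraicClosure k)ˣ) : (AlgebraicClosure k)ˣ)⁻¹ := by
  change ((Additive.toMul (D'.muTorsionHom z) : CommGroup.torsion (AlgebraicClosure k)ˣ) :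
      (AlgebraicClosure k)ˣ) =
    ((Additive.toMul (D.muTorsionHom z) : CommGroup.torsion (AlgebraicClosure k)ˣ) : (AlgebraicClosure k)ˣ)⁻¹
  rw [coe_muTorsionHom, coe_muTorsionHom, muLift_eq_neg_of_inv_twist h z]
  rfl

/-- **The two identifications differ**: if `k̄` has a root of unity of order `> 2` (always, in
characteristic `0`: a primitive cube root), the inverse twist `D'` has `D'.equiv ≠ D.equiv`.  So the
(T1)–(T4) data — and every junction built on a CHOSEN datum — are determined only up to (at least) `±1`.
[cite: MochizukiAbsTopIII2015, Remark 3.2.1 p.73] -/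
theorem equiv_ne_of_inv_twist {D D' : TorsionReciprocityData k}
    (h : ∀ (U : OpenSubgroup (Field.absoluteGaloisGroup k))
      (x : abelianizationTorsion (U : Subgroup (Field.absoluteGaloisGroup k))), D'.θ U x = (D.θ U x)⁻¹) :
    D'.equiv ≠ D.equiv := by
  intro heq
  -- a primitive cube root of unity `ζ` in `k̄`, as a torsion unit
  haveI : NeZero ((3 : ℕ) : AlgebraicClosure k) := ⟨Nat.cast_ne_zero.2 (by norm_num)⟩
  obtain ⟨ζ, hζ⟩ := HasEnoughRootsOfUnity.exists_primitiveRoot (AlgebraicClosure k) 3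
  have hζ0 : ζ ≠ 0 := hζ.ne_zero (by norm_num)
  let ζu : (AlgebraicClosure k)ˣ := Units.mk0 ζ hζ0
  have hζu : ζu ∈ CommGroup.torsion (AlgebraicClosure k)ˣ := by
    rw [CommGroup.mem_torsion, isOfFinOrder_iff_pow_eq_one]
    exact ⟨3, by norm_num, Units.ext (by rw [Units.val_pow_eq_pow_val, Units.val_mk0, hζ.pow_eq_one, Units.val_one])⟩
  -- it is `D.equiv z` for some `z`; then `D'.equiv z = ζ⁻¹ ≠ ζ`
  obtain ⟨z, hz⟩ := D.equiv.surjective (Additive.ofMul ⟨ζu, hζu⟩)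
  have e := coe_equiv_of_inv_twist h z
  rw [heq, hz] at e
  change ζu = ζu⁻¹ at e
  have e' : ζ * ζ = 1 := by
    have := congrArg (fun u : (AlgebraicClosure k)ˣ => ((u * ζu : (AlgebraicClosure k)ˣ) : AlgebraicClosure k)) e
    simpa [ζu] using this
  have h2 : ζ ^ 2 = 1 := by rw [pow_two, e']
  have := hζ.pow_eq_one_iff_dvd 2 |>.mp h2
  omega

/-- **Non-uniqueness of torsion reciprocity data** for a non-archimedean local field of characteristic
`0`: there are two data with DIFFERENT identifications `μ_{ℚ/ℤ}(G_k) ≅ μ(k̄)` (the LCFT datum and its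
inverse twist).  Consequently `Classical.choice`-based junctions (`MLFClosure.reciprocityData` and the
like) agree with print's canonical identification of Rmk 3.2.1 only up to a twist, which print removes by
the `H²`-compatibility of Rmk 3.2.1. [cite: MochizukiAbsTopIII2015, Remark 3.2.1 p.73] -/
theorem exists_ne (k : Type u) [Field k] [CharZero k] [ValuativeRel k] [TopologicalSpace k]
    [IsNonarchimedeanLocalField k] :
    ∃ D D' : TorsionReciprocityData k, D'.equiv ≠ D.equiv := by
  obtain ⟨D⟩ := nonempty_torsionReciprocityData k
  obtain ⟨D', h⟩ := D.exists_inv_twist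
  exact ⟨D, D', equiv_ne_of_inv_twist h⟩

end TorsionReciprocityData

end Literature.AnabelianGeometry.AbsoluteAnabelian

end
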